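import Mathlib
import HarnessLib
import Literature.Analysis.FluidPDE.SuitableWeak
import Literature.Analysis.FluidPDE.SelfSimilar
import Literature.Analysis.FluidPDE.LocalTypeI
import Literature.Analysis.FluidPDE.SpaceTimeRescaling
import Literature.Analysis.FluidPDE.LocalTypeIScaling
import Literature.Analysis.FluidPDE.LocalTypeIReverseZoom
import Literature.Analysis.FluidPDE.LerayHopfNSRescale
import Summits.NavierStokesRegularity.NavierStokesRegularity.Theorems.RellichScarApexLocalisationApexOfDecaying

/-!
# Zoom covariance of the apex class (helper for `RellichScar.SimilarityCovariance`)

The apex class of route RellichScar — suitable weak solutions `(u, p)` of Navier–Stokes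
(`ν = 1`, `f = 0`) on the slab `ℝ³ × (−∞, 0)` with a weak spatial gradient `G`, Albritton–Barker
quantity `𝐈(ℝ³ × ℝ₋) < ∞`, the space–time Type-I bound `|u| ≤ C/(|x| + √−t)` and a backward
singular point at the origin — is invariant under the Navier–Stokes rescaling about the origin
`u ↦ λ u(λ² t, λ x)`, `p ↦ λ² p(λ² t, λ x)`, `G ↦ λ² G(λ² t, λ x)` (`λ > 0`), with the SAME `C`.
Pure bookkeeping over accepted tree lemmas: `zoom_isSuitableWeakSolutionOn`,
`zoom_hasWeakSpatialGradientOn` (`LocalTypeIReverseZoom.lean`; CKN 1982, §2 scaling through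
`IsSuitableWeakSolutionOn.stRescale`), `typeIBound_lowerHalf_nsZoom`, `eLpNorm_top_nsZoom`
(`LocalTypeIScaling.lean`; Albritton–Barker 2019, §3), `HasTypeIDecay.nsRescale` (KNSS 2009,
(1.6)), with the dictionary `nsRescale λ u = λ • stPull (λ²) λ 0 0 u`
(`Literature.Analysis.FluidPDE.nsRescale_eq_smul_stPull`) and the invariance of the slab under
the zoom (`RellichScarApexLocalisation.stPreimage_slab_origin`).

Sources: L. Caffarelli, R. Kohn, L. Nirenberg, CPAM 35 (1982), §2; G. Koch, N. Nadirashvili,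
G. Seregin, V. Šverák, Acta Math. 203 (2009), §1 (1.6); D. Albritton, T. Barker, JMFM 21 (2019), §3.
-/

-- the summit and its single sub-problem share the name (CONVENTIONS §1), as in every Theorems file
set_option linter.dupNamespace false

namespace Summit.NavierStokesRegularity.NavierStokesRegularity.Theorems.RellichScarSimilarityCovariance

namespace Zoom

open MeasureTheory Set Function Metric Filter TopologicalSpace
open scoped ENNReal NNReal
open Literature.Analysis Literature.Analysis.FluidPDE

/-- **Scaling covariance of the suitable weak class on the slab** (CKN 1982, §2): if `(u, p)` is
a suitable weak solution (`ν = 1`, `f = 0`) on `ℝ³ × (−∞, 0)`, then so is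
`(λ u(λ²t, λx), λ² p(λ²t, λx))` for every `λ > 0`. -/
theorem isSuitableWeakSolutionOn_nsRescale
    {u : ℝ → EuclideanSpace ℝ (Fin 3) → EuclideanSpace ℝ (Fin 3)}
    {p : ℝ → EuclideanSpace ℝ (Fin 3) → ℝ}
    (h : IsSuitableWeakSolutionOn (slab (EuclideanSpace ℝ (Fin 3)) (Iio 0) isOpen_Iio) 1 0 u p)
    {lam : ℝ} (hlam : 0 < lam) :
    IsSuitableWeakSolutionOn (slab (EuclideanSpace ℝ (Fin 3)) (Iio 0) isOpen_Iio) 1 0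
      (nsRescale lam u) (lam ^ 2 • stPull (lam ^ 2) lam 0 0 p) := by
  have key := zoom_isSuitableWeakSolutionOn h hlam 0 (0 : EuclideanSpace ℝ (Fin 3))
  rw [RellichScarApexLocalisation.stPreimage_slab_origin hlam] at key
  rw [Literature.Analysis.FluidPDE.nsRescale_eq_smul_stPull]
  exact key

/-- **Scaling covariance of weak spatial gradients on the slab**: if `G` is a weak spatial
gradient of `u` on `ℝ³ × (−∞, 0)`, then `λ² G(λ²t, λx)` is one of `λ u(λ²t, λx)`. -/
theorem hasWeakSpatialGradientOn_nsRescale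
    {u : ℝ → EuclideanSpace ℝ (Fin 3) → EuclideanSpace ℝ (Fin 3)}
    {G : ℝ → EuclideanSpace ℝ (Fin 3) → EuclideanSpace ℝ (Fin 3) →L[ℝ] EuclideanSpace ℝ (Fin 3)}
    (h : HasWeakSpatialGradientOn (slab (EuclideanSpace ℝ (Fin 3)) (Iio 0) isOpen_Iio) u G)
    {lam : ℝ} (hlam : 0 < lam) :
    HasWeakSpatialGradientOn (slab (EuclideanSpace ℝ (Fin 3)) (Iio 0) isOpen_Iio)
      (nsRescale lam u) (lam ^ 2 • stPull (lam ^ 2) lam 0 0 G) := by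
  have key := zoom_hasWeakSpatialGradientOn h hlam 0 (0 : EuclideanSpace ℝ (Fin 3))
  rw [RellichScarApexLocalisation.stPreimage_slab_origin hlam] at key
  rw [Literature.Analysis.FluidPDE.nsRescale_eq_smul_stPull]
  exact key

/-- **Scale invariance of `𝐈(ℝ³ × ℝ₋)`** (Albritton–Barker 2019, §3): the Type-I quantity of the
rescaled triple equals that of `(u, p, G)`. -/
theorem typeIBound_nsRescale (u : ℝ → EuclideanSpace ℝ (Fin 3) → EuclideanSpace ℝ (Fin 3))
    (p : ℝ → EuclideanSpace ℝ (Fin 3) → ℝ)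
    (G : ℝ → EuclideanSpace ℝ (Fin 3) → EuclideanSpace ℝ (Fin 3) →L[ℝ] EuclideanSpace ℝ (Fin 3))
    {lam : ℝ} (hlam : 0 < lam) :
    typeIBound (Iio (0 : ℝ) ×ˢ univ) (nsRescale lam u) (lam ^ 2 • stPull (lam ^ 2) lam 0 0 p)
        (lam ^ 2 • stPull (lam ^ 2) lam 0 0 G) =
      typeIBound (Iio (0 : ℝ) ×ˢ univ) u p G := by
  rw [Literature.Analysis.FluidPDE.nsRescale_eq_smul_stPull]
  exact typeIBound_lowerHalf_nsZoom hlam u p G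

/-- **The origin stays singular under rescaling**: `‖u_λ‖_{L^∞(Q(0, r))} = λ ‖u‖_{L^∞(Q(0, λ r))}`
(A–B 2019, §3), so a backward singular point of `u` at the origin is one of `u_λ`. -/
theorem isBackwardSingularPoint_nsRescale
    {u : ℝ → EuclideanSpace ℝ (Fin 3) → EuclideanSpace ℝ (Fin 3)} (h : IsBackwardSingularPoint u 0)
    {lam : ℝ} (hlam : 0 < lam) : IsBackwardSingularPoint (nsRescale lam u) 0 := by
  intro r hr
  rw [Literature.Analysis.FluidPDE.nsRescale_eq_smul_stPull,
    eLpNorm_top_nsZoom hlam 0 (0 : EuclideanSpace ℝ (Fin 3)) r 0 u]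
  have h0 : stAffine (lam ^ 2) lam 0 (0 : EuclideanSpace ℝ (Fin 3)) 0 = 0 := by
    simp [stAffine, Prod.ext_iff]
  rw [h0, h (lam * r) (mul_pos hlam hr)]
  exact ENNReal.mul_top (by simpa using hlam)

/-- **Scaling half of `SimilarityCovariance`**: the apex class with constant `C` and the
singularity of the origin are invariant under `u ↦ λ u(λ² t, λ x)` (`λ > 0`), with pressure
`λ² p(λ² t, λ x)` and gradient `λ² G(λ² t, λ x)`. -/
theorem apexClass_nsRescale {u : ℝ → EuclideanSpace ℝ (Fin 3) → EuclideanSpace ℝ (Fin 3)}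
    {p : ℝ → EuclideanSpace ℝ (Fin 3) → ℝ}
    {G : ℝ → EuclideanSpace ℝ (Fin 3) → EuclideanSpace ℝ (Fin 3) →L[ℝ] EuclideanSpace ℝ (Fin 3)}
    {C : ℝ}
    (hsw : IsSuitableWeakSolutionOn (slab (EuclideanSpace ℝ (Fin 3)) (Iio 0) isOpen_Iio) 1 0 u p)
    (hG : HasWeakSpatialGradientOn (slab (EuclideanSpace ℝ (Fin 3)) (Iio 0) isOpen_Iio) u G)
    (hI : typeIBound (Iio (0 : ℝ) ×ˢ univ) u p G < ⊤) (hC : HasTypeIDecay C u)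
    (hsing : IsBackwardSingularPoint u 0) {lam : ℝ} (hlam : 0 < lam) :
    ∃ (q : ℝ → EuclideanSpace ℝ (Fin 3) → ℝ)
      (H : ℝ → EuclideanSpace ℝ (Fin 3) → EuclideanSpace ℝ (Fin 3) →L[ℝ] EuclideanSpace ℝ (Fin 3)),
      IsSuitableWeakSolutionOn (slab (EuclideanSpace ℝ (Fin 3)) (Iio 0) isOpen_Iio) 1 0
        (nsRescale lam u) q ∧
      HasWeakSpatialGradientOn (slab (EuclideanSpace ℝ (Fin 3)) (Iio 0) isOpen_Iio)
        (nsRescale lam u) H ∧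
      typeIBound (Iio (0 : ℝ) ×ˢ univ) (nsRescale lam u) q H < ⊤ ∧
      HasTypeIDecay C (nsRescale lam u) ∧ IsBackwardSingularPoint (nsRescale lam u) 0 :=
  ⟨lam ^ 2 • stPull (lam ^ 2) lam 0 0 p, lam ^ 2 • stPull (lam ^ 2) lam 0 0 G,
    isSuitableWeakSolutionOn_nsRescale hsw hlam, hasWeakSpatialGradientOn_nsRescale hG hlam,
    by rwa [typeIBound_nsRescale u p G hlam], hC.nsRescale hlam,
    isBackwardSingularPoint_nsRescale hsing hlam⟩

end Zoom

end Summit.NavierStokesRegularity.NavierStokesRegularity.Theorems.RellichScarSimilarityCovariance
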